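import Summits.QuantumFields.BalabanUV.T4Continuum.Support.OutputRateComplexSlice

/-!
# OutputRateComplexSliceImage — slice letters for IMAGE families: holomorphy and bounds along a complex slice pass from a member
# family to its images under holomorphic image maps (affine ∕ sandwich ∕ inverse-on-units) — ruling R51 (5)

Cell `pub-balaban`, unit `b2b-balaban-t4-ne5-p1` (row NE5 OWNER, gen 36; owner item «g36-d», ruling R51 (5), `HOME/CLAIMS.log` l.18137).
Summits-side NEW WORK under the LEAN PLACEMENT RULE ([folklore] one-variable complex analysis over ABSTRACT Banach algebras; nothing printed is
asserted; no `[cite:]`; no `Prop`-valued fact minted; 0 `def`).  HONEST FRAMING: rung (B)+1 of the FINITE-VOLUME T⁴ continuum programme — NOT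
infinite volume, NOT a mass gap, NOT the Clay problem, NOT a proof of NE5 (NOT PRINTED; GAPS G-t4-U3-1), NOT a proof of NE2 or NE3.  HONEST
DEPENDENCY (cell, verbatim): continuum YM on T⁴ ⇐ BetaPertH ∧ nine spine estimates (0/9 proved); BetaPertH ⇐ (D1) ∧ (D4) ∧ CAP+tail; G-an2-4
gates asym, D1 and NE2/3/4.

WHY.  On Road D the W1 binder at complex chart points is produced by the two-constants junction (`OutputRateComplexSlice`, p225933) from the
real-point rate plus, per operator family, ONE slice letter: holomorphy in the open unit disc, continuity on the closed disc, a uniform bound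
there (the `hslice` clauses of `operatorRate_complex_of_realSlice_each`).  The substrate PROVES these letters for the covariance and Green
species (L-E12 ∕ W-17b).  The Δ ∕ Γ species of W1 of record are IMAGES of the tower member (`B13ReadingsImage`, p221588: affine, sandwich,
inverse-on-coercive images; `B13ReadingsDelta`, p221950).  Ruling R51 (5): an image family inherits the slice letter from the member when the
image map is holomorphic on a neighbourhood of the member's slice values — typed here once, abstractly, so that an instancer supplies the Δ ∕ Γ
slice letters BY NAME from the member's.

WHAT ([folklore]; 0 def).  For a slice `c : ℂ → 𝔄` (a member family read along `γ`, `c = memb ∘ γ`) with `DiffContOnCl ℂ c (ball 0 1)`: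
* `diffContOnCl_image` : `Φ ∘ c` is `DiffContOnCl` on the disc if `Φ` is differentiable on an OPEN set `U` receiving the closed-disc values of `c`.
* `diffContOnCl_affine` ∕ `norm_affine_le` : `z ↦ a + L (c z)` (`L` continuous linear), bound `‖a‖ + ‖L‖·B`.
* `diffContOnCl_sandwich` ∕ `norm_sandwich_le` : `z ↦ A * c z * A′` in a normed algebra, bound `‖A‖·B·‖A′‖`.
* `diffContOnCl_inverse` : `z ↦ Ring.inverse (c z)` when every closed-disc value is a unit (complete normed algebra: Mathlib `differentiableOn_inverse`
  on the OPEN set of units); its bound IS the displayed coercivity letter `‖(c z)⁻¹‖ ≤ γ₀⁻¹` ([Balaban1984PropagatorsI] (1.67) KIND — an upper bound on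
  the inverse, asserted by nobody); `norm_inverse_sub_inverse_le` (resolvent identity: `‖a⁻¹ − b⁻¹‖ ≤ γ₀⁻¹·‖a − b‖·γ₀⁻¹`, for the difference form).
* `hslice_image` : the seven-clause `hslice` package of p225933 `_each` for two IMAGE families from the two members' packages and the image maps'
  holomorphy ∕ bounds — the shape an instancer feeds to `operatorRate_complex_of_realSlice_each` for an image species.
WHAT IS NOT HERE.  No instance (which member, which image map per species is `B13ReadingsImage`'s dictionary and the substrate's O1); no
estimate of [II]; the coercivity letter is displayed.  0 sorry; axioms ⊆ {propext, Classical.choice, Quot.sound}.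
-/

noncomputable section

open Complex Set Metric

namespace Summit.QuantumFields.BalabanUV.T4Continuum.OutputRateComplexSliceImage

variable {𝔄 𝔅 : Type*} [NormedAddCommGroup 𝔄] [NormedSpace ℂ 𝔄] [NormedAddCommGroup 𝔅] [NormedSpace ℂ 𝔅]

/-! ## §1 Generic: holomorphic images of a `DiffContOnCl` slice -/

/-- [folklore] **IMAGES OF A SLICE UNDER A MAP HOLOMORPHIC NEAR ITS VALUES.**  If `c` is holomorphic in the open unit disc and continuous on the
closed disc, and `Φ` is (complex-)differentiable on an OPEN set `U` containing all closed-disc values of `c`, then `Φ ∘ c` is holomorphic in the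
open disc and continuous on the closed disc. -/
theorem diffContOnCl_image {c : ℂ → 𝔄} {Φ : 𝔄 → 𝔅} {U : Set 𝔄} (hU : IsOpen U) (hΦ : DifferentiableOn ℂ Φ U)
    (hc : DiffContOnCl ℂ c (ball 0 1)) (hmaps : ∀ z : ℂ, ‖z‖ ≤ 1 → c z ∈ U) :
    DiffContOnCl ℂ (fun z => Φ (c z)) (ball 0 1) := by
  have hcl : closure (ball (0 : ℂ) 1) = closedBall 0 1 := closure_ball 0 one_ne_zero
  have hmaps' : MapsTo c (closure (ball (0 : ℂ) 1)) U := fun z hz => by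
    rw [hcl, mem_closedBall, dist_zero_right] at hz
    exact hmaps z hz
  refine ⟨?_, ?_⟩
  · intro z hz
    have hzU : c z ∈ U := hmaps' (subset_closure hz)
    exact ((hΦ (c z) hzU).differentiableAt (hU.mem_nhds hzU)).comp_differentiableWithinAt z (hc.differentiableOn z hz)
  · exact hΦ.continuousOn.comp hc.continuousOn hmaps'

/-! ## §2 Affine images -/

/-- [folklore] **AFFINE IMAGE** `z ↦ a + L (c z)` (`L` continuous ℂ-linear): holomorphic in the disc, continuous on the closed disc. -/
theorem diffContOnCl_affine {c : ℂ → 𝔄} (hc : DiffContOnCl ℂ c (ball 0 1)) (a : 𝔅) (L : 𝔄 →L[ℂ] 𝔅) :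
    DiffContOnCl ℂ (fun z => a + L (c z)) (ball 0 1) :=
  (diffContOnCl_const (c := a)).add (L.differentiable.comp_diffContOnCl hc)

/-- [folklore] Bound of the affine image on the closed disc: `‖a + L (c z)‖ ≤ ‖a‖ + ‖L‖·B`. -/
theorem norm_affine_le {c : ℂ → 𝔄} {B : ℝ} (hb : ∀ z : ℂ, ‖z‖ ≤ 1 → ‖c z‖ ≤ B) (a : 𝔅) (L : 𝔄 →L[ℂ] 𝔅) :
    ∀ z : ℂ, ‖z‖ ≤ 1 → ‖a + L (c z)‖ ≤ ‖a‖ + ‖L‖ * B := fun z hz =>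
  calc ‖a + L (c z)‖ ≤ ‖a‖ + ‖L (c z)‖ := norm_add_le _ _
    _ ≤ ‖a‖ + ‖L‖ * ‖c z‖ := by gcongr; exact L.le_opNorm _
    _ ≤ ‖a‖ + ‖L‖ * B := by gcongr; exact hb z hz

/-! ## §3 Sandwich images in a normed algebra -/

section Algebra

variable {R : Type*} [NormedRing R] [NormedAlgebra ℂ R]

/-- [folklore] **SANDWICH IMAGE** `z ↦ A * c z * A′`: holomorphic in the disc, continuous on the closed disc. -/
theorem diffContOnCl_sandwich {c : ℂ → R} (hc : DiffContOnCl ℂ c (ball 0 1)) (A A' : R) :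
    DiffContOnCl ℂ (fun z => A * c z * A') (ball 0 1) := by
  have h1 : Differentiable ℂ fun x : R => A * x * A' := (differentiable_id.const_mul A).mul_const A'
  exact h1.comp_diffContOnCl hc

omit [NormedAlgebra ℂ R] in
/-- [folklore] Bound of the sandwich image on the closed disc: `‖A * c z * A′‖ ≤ ‖A‖·B·‖A′‖`. -/
theorem norm_sandwich_le {c : ℂ → R} {B : ℝ} (hb : ∀ z : ℂ, ‖z‖ ≤ 1 → ‖c z‖ ≤ B) (A A' : R) :
    ∀ z : ℂ, ‖z‖ ≤ 1 → ‖A * c z * A'‖ ≤ ‖A‖ * B * ‖A'‖ := fun z hz =>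
  calc ‖A * c z * A'‖ ≤ ‖A * c z‖ * ‖A'‖ := norm_mul_le _ _
    _ ≤ ‖A‖ * ‖c z‖ * ‖A'‖ := mul_le_mul_of_nonneg_right (norm_mul_le _ _) (norm_nonneg _)
    _ ≤ ‖A‖ * B * ‖A'‖ := by gcongr; exact hb z hz

/-! ## §4 Inverse images on units (complete normed algebra) -/

variable [CompleteSpace R]

/-- [folklore] **INVERSE IMAGE** `z ↦ Ring.inverse (c z)` (the honest inverse on units): if every closed-disc value of `c` is a unit, the
inverse slice is holomorphic in the disc and continuous on the closed disc (Mathlib `differentiableOn_inverse` on the OPEN set of units,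
`Units.isOpen`). -/
theorem diffContOnCl_inverse {c : ℂ → R} (hc : DiffContOnCl ℂ c (ball 0 1)) (hu : ∀ z : ℂ, ‖z‖ ≤ 1 → IsUnit (c z)) :
    DiffContOnCl ℂ (fun z => Ring.inverse (c z)) (ball 0 1) :=
  diffContOnCl_image Units.isOpen differentiableOn_inverse hc hu

omit [NormedAlgebra ℂ R] [CompleteSpace R] in
/-- [folklore] **DIFFERENCE OF INVERSES along the slice** (the resolvent identity, for the five-clause DIFFERENCE form of p225933): on units,
`Ring.inverse a − Ring.inverse b = Ring.inverse a * (b − a) * Ring.inverse b`, hence `‖a⁻¹ − b⁻¹‖ ≤ γ₀⁻¹·‖a − b‖·γ₀⁻¹` under the coercivity letters. -/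
theorem norm_inverse_sub_inverse_le {a b : R} (ha : IsUnit a) (hb : IsUnit b) {γ₀ : ℝ} (hγ : 0 < γ₀)
    (hia : ‖Ring.inverse a‖ ≤ γ₀⁻¹) (hib : ‖Ring.inverse b‖ ≤ γ₀⁻¹) :
    ‖Ring.inverse a - Ring.inverse b‖ ≤ γ₀⁻¹ * ‖a - b‖ * γ₀⁻¹ := by
  obtain ⟨ua, rfl⟩ := ha
  obtain ⟨ub, rfl⟩ := hb
  rw [Ring.inverse_unit, Ring.inverse_unit] at *
  have key : (↑ua⁻¹ : R) - ↑ub⁻¹ = ↑ua⁻¹ * ((ub : R) - ua) * ↑ub⁻¹ := by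
    rw [mul_sub, sub_mul, Units.mul_inv_cancel_right, Units.inv_mul, one_mul]
  rw [key]
  calc ‖(↑ua⁻¹ : R) * ((ub : R) - ua) * ↑ub⁻¹‖ ≤ ‖(↑ua⁻¹ : R) * ((ub : R) - ua)‖ * ‖(↑ub⁻¹ : R)‖ := norm_mul_le _ _
    _ ≤ ‖(↑ua⁻¹ : R)‖ * ‖(ub : R) - ua‖ * ‖(↑ub⁻¹ : R)‖ := mul_le_mul_of_nonneg_right (norm_mul_le _ _) (norm_nonneg _)
    _ ≤ γ₀⁻¹ * ‖(ua : R) - ub‖ * γ₀⁻¹ := by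
        rw [norm_sub_rev]
        have h0 : 0 ≤ γ₀⁻¹ := inv_nonneg.mpr hγ.le
        gcongr

end Algebra

/-! ## §5 The seven-clause `hslice` package for two image families -/

/-- [folklore] **THE `hslice` PACKAGE OF p225933 `_each` FOR TWO IMAGE FAMILIES.**  Given, through a chart point `u`, ONE slice `γ` with the
member families' seven clauses (depth, base point, real diameter, holomorphy of `mA ∘ γ` and `mB ∘ γ`, closed-disc bounds `BA`, `BB`) and two
image maps `ΦA ΦB` differentiable on open sets receiving the closed-disc values, with displayed bounds `CA`, `CB` of the images along the slice:
the seven clauses for the image families `ΦA ∘ mA`, `ΦB ∘ mB` along the SAME slice. -/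
theorem hslice_image {𝒱 : Type} {mA mB : 𝒱 → 𝔄} {ΦA ΦB : 𝔄 → 𝔅} {UA UB : Set 𝔄} {real : Set 𝒱} {u : 𝒱} {r CA CB : ℝ}
    (hUA : IsOpen UA) (hUB : IsOpen UB) (hΦA : DifferentiableOn ℂ ΦA UA) (hΦB : DifferentiableOn ℂ ΦB UB)
    (h : ∃ γ : ℂ → 𝒱, ∃ z₀ : ℂ, ‖z₀‖ ≤ r ∧ γ z₀ = u ∧ (∀ x : ℝ, |x| < 1 → γ x ∈ real) ∧
      DiffContOnCl ℂ (fun z => mA (γ z)) (ball 0 1) ∧ DiffContOnCl ℂ (fun z => mB (γ z)) (ball 0 1) ∧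
        (∀ z : ℂ, ‖z‖ ≤ 1 → mA (γ z) ∈ UA) ∧ (∀ z : ℂ, ‖z‖ ≤ 1 → mB (γ z) ∈ UB) ∧
        (∀ z : ℂ, ‖z‖ ≤ 1 → ‖ΦA (mA (γ z))‖ ≤ CA) ∧ ∀ z : ℂ, ‖z‖ ≤ 1 → ‖ΦB (mB (γ z))‖ ≤ CB) :
    ∃ γ : ℂ → 𝒱, ∃ z₀ : ℂ, ‖z₀‖ ≤ r ∧ γ z₀ = u ∧ (∀ x : ℝ, |x| < 1 → γ x ∈ real) ∧
      DiffContOnCl ℂ (fun z => ΦA (mA (γ z))) (ball 0 1) ∧ DiffContOnCl ℂ (fun z => ΦB (mB (γ z))) (ball 0 1) ∧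
        (∀ z : ℂ, ‖z‖ ≤ 1 → ‖ΦA (mA (γ z))‖ ≤ CA) ∧ ∀ z : ℂ, ‖z‖ ≤ 1 → ‖ΦB (mB (γ z))‖ ≤ CB := by
  obtain ⟨γ, z₀, hz₀, hγu, hreal, hA, hB, hmA, hmB, hbA, hbB⟩ := h
  exact ⟨γ, z₀, hz₀, hγu, hreal, diffContOnCl_image hUA hΦA hA hmA, diffContOnCl_image hUB hΦB hB hmB, hbA, hbB⟩

end Summit.QuantumFields.BalabanUV.T4Continuum.OutputRateComplexSliceImage

end
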